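/-
Copyright (c) 2026. All rights reserved.
Released under Apache 2.0 license as described in the file LICENSE.
Authors: abc-iut cell, campaign-S prover seat abc-iut-S1 (wave 1).
-/
import Literature.IUT.LogVolume.LogSeriesEstimates
import HarnessLib

/-!
# The kernel of the `p`-adic logarithm on `𝒪_K^×` is the torsion `μ(K)`

Companion of `LocalUnitLog.lean` / `LogSeriesEstimates.lean` ([IUTchIV] §1: Prop. 1.4, kurims p. 13,
uses `R^μ ⊆ R^×`, "the torsion subgroup of `R_i^×`", and `R^{×μ} := R^×/R^μ`, through the fact that
`log_p` factors through `R^{×μ}` with image `log_p(R^×)`; [AbsTopIII] Def. 3.1).  For a unit `u` of a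
mixed-characteristic local field `K` (norm-side setting, `K` proper):

* `norm_one_sub_pow_prime_le` — `‖1 − y^p‖ ≤ ‖1 − y‖ · max(‖p‖, ‖1 − y‖^{p−1})` for a principal unit `y`
  (`(1 − t)^p = 1 + (−t)^p + p·(−t)·r`, `‖r‖ ≤ 1`), hence `y^{pᴺ} → 1` (`exists_norm_one_sub_pow_le`);
* `unitLog_eq_zero_iff` — **`log_p u = 0 ↔ u` is a root of unity** (`⇐` is
  `unitLog_eq_zero_of_pow_eq_one`; `⇒`: `L(u^m) = 0`, push `u^m` into the ball where `L` is injective by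
  `pᴺ`-th powers, `L((u^m)^{pᴺ}) = pᴺ·L(u^m) = 0 = L(1)`).

Classical (Neukirch ANT II (5.5); Koblitz GTM 58 Ch. IV §2); no named facts.
-/

noncomputable section

open Filter Metric
open _root_.Topology
open IsUltrametricDist

namespace Literature.IUT.LogVolume

open Literature.NumberTheory.Transcendental

variable (p : ℕ) [Fact p.Prime]
variable (K : Type*) [NontriviallyNormedField K] [instK : NormedAlgebra ℚ_[p] K] [IsUltrametricDist K]
include instK

omit instK in
open scoped NormedField in
/-- **`‖1 − y^p‖ ≤ ‖1 − y‖ · max(‖p‖, ‖1 − y‖^{p−1})`** for `‖1 − y‖ ≤ 1`: in `𝒪 = {‖x‖ ≤ 1}`,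
`(1 − t)^p = 1 + (−t)^p + p·(−t)·r` with `‖r‖ ≤ 1`. [cite: NeukirchANT1999, Ch. II (5.5)] -/
theorem norm_one_sub_pow_prime_le {y : K} (hy : ‖1 - y‖ ≤ 1) :
    ‖1 - y ^ p‖ ≤ ‖1 - y‖ * max ‖(p : K)‖ (‖1 - y‖ ^ (p - 1)) := by
  have hp : p.Prime := Fact.out
  set t : K := 1 - y with ht
  have hyt : y = 1 + -t := by rw [ht]; ring
  set T : Valued.integer K := ⟨t, Valued.integer.mem_iff.mpr hy⟩ with hT
  obtain ⟨r, hr⟩ := exists_add_pow_prime_eq hp (1 : Valued.integer K) (-T)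
  have hr' : ((1 : K) + -t) ^ p = 1 + (-t) ^ p + (p : K) * 1 * (-t) * (r : K) := by
    have := congrArg (fun z : Valued.integer K ↦ (z : K)) hr
    simpa [hT] using this
  have hrn : ‖(r : K)‖ ≤ 1 := Valued.integer.norm_le_one r
  have hcalc : 1 - y ^ p = -((-t) ^ p) + -((p : K) * 1 * (-t) * (r : K)) := by
    rw [hyt, hr']; ring
  rw [hcalc]
  refine (norm_add_le_max _ _).trans ?_
  rw [norm_neg, norm_neg, norm_pow, norm_neg, norm_mul, norm_mul, norm_mul, norm_one, mul_one,
    norm_neg]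
  have ht0 : 0 ≤ ‖t‖ := norm_nonneg t
  have hp1 : p - 1 + 1 = p := Nat.sub_add_cancel hp.one_lt.le
  refine max_le ?_ ?_
  · calc ‖t‖ ^ p = ‖t‖ * ‖t‖ ^ (p - 1) := by
          conv_lhs => rw [← hp1, pow_succ']
      _ ≤ ‖t‖ * max ‖(p : K)‖ (‖t‖ ^ (p - 1)) := by gcongr; exact le_max_right _ _
  · calc ‖(p : K)‖ * ‖t‖ * ‖(r : K)‖ ≤ ‖(p : K)‖ * ‖t‖ * 1 := by gcongr
      _ = ‖t‖ * ‖(p : K)‖ := by ring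
      _ ≤ ‖t‖ * max ‖(p : K)‖ (‖t‖ ^ (p - 1)) := by gcongr; exact le_max_left _ _

/-- Iterating: `‖1 − y^{pᴺ}‖ ≤ c^N · ‖1 − y‖` with `c = max(‖p‖, ‖1 − y‖^{p−1})` (the contraction factor
does not increase along the iteration). [cite: NeukirchANT1999, Ch. II (5.5)] -/
theorem norm_one_sub_pow_prime_pow_le {y : K} (hy : ‖1 - y‖ ≤ 1) (N : ℕ) :
    ‖1 - y ^ (p ^ N)‖ ≤ (max ‖(p : K)‖ (‖1 - y‖ ^ (p - 1))) ^ N * ‖1 - y‖ := by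
  set c := max ‖(p : K)‖ (‖1 - y‖ ^ (p - 1)) with hc
  have hc0 : 0 ≤ c := le_max_of_le_left (norm_nonneg _)
  have hc1 : c ≤ 1 := max_le (IwasawaLog.norm_natCast_le_one p (F := K) p) (pow_le_one₀ (norm_nonneg _) hy)
  induction N with
  | zero => simp
  | succ N ih =>
    have hyN : ‖1 - y ^ (p ^ N)‖ ≤ ‖1 - y‖ := by
      refine ih.trans ?_
      calc c ^ N * ‖1 - y‖ ≤ 1 * ‖1 - y‖ := by gcongr; exact pow_le_one₀ hc0 hc1
        _ = ‖1 - y‖ := one_mul _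
    have hyN1 : ‖1 - y ^ (p ^ N)‖ ≤ 1 := hyN.trans hy
    have hstep := norm_one_sub_pow_prime_le p K hyN1
    rw [pow_succ, pow_mul]
    refine hstep.trans ?_
    have hmax : max ‖(p : K)‖ (‖1 - y ^ (p ^ N)‖ ^ (p - 1)) ≤ c := by
      refine max_le (le_max_left _ _) ((pow_le_pow_left₀ (norm_nonneg _) hyN _).trans (le_max_right _ _))
    calc ‖1 - y ^ (p ^ N)‖ * max ‖(p : K)‖ (‖1 - y ^ (p ^ N)‖ ^ (p - 1))
        ≤ (c ^ N * ‖1 - y‖) * c := by gcongr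
      _ = c ^ (N + 1) * ‖1 - y‖ := by ring

/-- **`y^{pᴺ} → 1` for a principal unit `y`**: for every `ε > 0` some `‖1 − y^{pᴺ}‖ ≤ ε`.
[cite: NeukirchANT1999, Ch. II (5.5)] -/
theorem exists_norm_one_sub_pow_le {y : K} (hy : ‖1 - y‖ < 1) {ε : ℝ} (hε : 0 < ε) :
    ∃ N : ℕ, ‖1 - y ^ (p ^ N)‖ ≤ ε := by
  set c := max ‖(p : K)‖ (‖1 - y‖ ^ (p - 1)) with hc
  have hp2 : 2 ≤ p := (Fact.out : p.Prime).two_le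
  have hc0 : 0 ≤ c := le_max_of_le_left (norm_nonneg _)
  have hc1 : c < 1 := max_lt (IwasawaLog.norm_prime_lt_one (p := p) (F := K))
    (pow_lt_one₀ (norm_nonneg _) hy (by omega))
  have hlim : Tendsto (fun N : ℕ ↦ c ^ N * ‖1 - y‖) atTop (𝓝 0) := by
    have := (tendsto_pow_atTop_nhds_zero_of_lt_one hc0 hc1).mul_const ‖1 - y‖
    rwa [zero_mul] at this
  obtain ⟨N, hN⟩ := (hlim.eventually (ge_mem_nhds hε)).exists
  exact ⟨N, (norm_one_sub_pow_prime_pow_le p K hy.le N).trans hN⟩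

/-- **The kernel of `log_p` on `𝒪_K^×` is the torsion**: for `‖u‖ = 1`, `log_p u = 0 ↔ uⁿ = 1` for some
`n ≥ 1` (so `log_p` factors through `R^{×μ} = R^×/R^μ`, [IUTchIV] Prop. 1.4, p. 13).
[cite: NeukirchANT1999, Ch. II (5.5)] -/
theorem unitLog_eq_zero_iff [ProperSpace K] {u : K} (hu : ‖u‖ = 1) :
    unitLog u = 0 ↔ ∃ n : ℕ, 0 < n ∧ u ^ n = 1 := by
  refine ⟨fun h ↦ ?_, fun ⟨n, hn, h⟩ ↦ unitLog_eq_zero_of_pow_eq_one p hn h⟩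
  haveI := IwasawaLog.charZero p (F := K)
  have hp : p.Prime := Fact.out
  have hp1 : (1 : ℝ) < p := by exact_mod_cast hp.one_lt
  have hp0 : (0 : ℝ) < p := by linarith
  obtain ⟨m, hm, -, hmP⟩ := exists_pow_isPrincipal_not_dvd (p := p) hu
  -- `L(u^m) = 0`
  have hL : logSeries (u ^ m) = 0 := by
    have h1 := unitLog_eq_inv_mul_logSeries p hm hmP
    rw [h] at h1
    have hm0 : ((m : ℕ) : K)⁻¹ ≠ 0 := inv_ne_zero (by exact_mod_cast hm.ne')
    exact (mul_eq_zero.mp h1.symm).resolve_left hm0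
  -- the injectivity ball: `ρ = p^{-2}`, `ρ · p^{1/(p-1)} ≤ p^{-1} < 1`
  set ρ : ℝ := (p : ℝ) ^ (-(2 : ℝ)) with hρ
  have hθ : ρ * (p : ℝ) ^ (1 / ((p : ℝ) - 1)) < 1 := by
    rw [hρ, ← Real.rpow_add hp0]
    refine Real.rpow_lt_one_of_one_lt_of_neg hp1 ?_
    have h2 : (2 : ℝ) ≤ p := by exact_mod_cast hp.two_le
    have : 1 / ((p : ℝ) - 1) ≤ 1 := by
      rw [div_le_one (by linarith)]; linarith
    linarith
  have hρ0 : 0 < ρ := Real.rpow_pos_of_pos hp0 _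
  obtain ⟨N, hN⟩ := exists_norm_one_sub_pow_le p K hmP hρ0
  -- `L((u^m)^{p^N}) = p^N L(u^m) = 0 = L(1)`; injectivity gives `(u^m)^{p^N} = 1`
  have hLN : logSeries ((u ^ m) ^ (p ^ N)) = logSeries (1 : K) := by
    rw [logSeries_pow p hmP, hL, mul_zero, logSeries_one]
  have hmem1 : (1 : K) ∈ {y : K | ‖1 - y‖ ≤ ρ} := by simp [hρ0.le]
  have hmem : (u ^ m) ^ (p ^ N) ∈ {y : K | ‖1 - y‖ ≤ ρ} := hN
  have heq := logSeries_injOn p K hθ hmem hmem1 hLN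
  refine ⟨m * p ^ N, Nat.mul_pos hm (pow_pos hp.pos N), ?_⟩
  rw [pow_mul, heq]

end Literature.IUT.LogVolume

end
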